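import Literature.AlgebraicGeometry.HodgeTheory.HodgeGenericQbarDescentProofs
import Literature.FieldTheory.AlgClosed.AutomorphismExtension
import HarnessLib

/-!
# Countable Galois orbits: a point of `S₀ ×_K Spec C` with countably many Galois conjugates is fixed

Topic `AlgebraicGeometry/HodgeTheory`; everything here is **proved** (no definitions, no named
facts). Companion of `HodgeGenericQbarDescentProofs.lean` (Lang's descent of `Aut(C/K)`-STABLE
closed sets of `S₀ ×_K Spec C`, III §2 Thm. 7 and §5): this file treats closed irreducible sets /
points whose orbit under the Galois twists `𝟙 × Spec τ`, `τ ∈ Aut(C/K)`, is merely COUNTABLE, and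
shows they are in fact fixed — the step "a subvariety with only countably many `Aut(ℂ/ℚ̄)`-conjugates
is defined over `ℚ̄`" of the field-of-definition arguments for components of Hodge loci and special
subvarieties (Voisin, *Hodge loci and absolute Hodge classes*, §1; Charles–Schnell, *Notes on
absolute Hodge classes*, §11.3; Klingler–Otwinowska–Urbanik, §1.2). The printed mechanism is the
smallest field of definition `k₀` of an ideal `𝔞 ⊆ Ω[X]` (Lang, *Introduction to Algebraic
Geometry*, III §2 Thm. 7: `𝔞^τ = 𝔞 ⟺ τ|k₀ = id`; Weil, *Foundations*, I §7 Lemma 2; EGA IV₂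
4.8.11–13): if `k₀ ⊄ K` it contains a transcendental, which `Aut(C/K)` moves to uncountably many
values, giving uncountably many conjugates. Formalised on the tree's carriers as follows.

* `finsupp_twist_mem_of_countable` — **a `C`-subspace `V ⊆ C^{(ι)}` whose orbit under the
  coordinatewise action of `Aut(C/K)` is countable is `Aut(C/K)`-stable**, assuming `Aut(C/K)` is
  transitive on `C ∖ K` and `C ∖ K` is uncountable. CANONICAL FORM replacing Lang's basis of
  monomials modulo the ideal: `V` is spanned by its *normalised minimal-support vectors*
  (`mem_span_minSupp`, the induction of `mem_span_fixedCoord_of_stable`), each unique given its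
  support and normalising index (`eq_of_minSupp_of_apply_eq_one`); if one has a coordinate
  `c ∉ K`, the conjugates `τ⁻¹ · V`, `τ c = c'`, are pairwise distinct for distinct `c' ∉ K`.
* `tensor_twist_mem_of_countable`, `ideal_comap_tensor_twist_eq_of_countable` — the same for an
  ideal of `C ⊗_K R` under the twists `τ ⊗ id` (coordinates in the basis `1 ⊗ bᵢ`,
  `basis_repr_map_algEquiv`).
* `twist_apply_eq_self_of_countable` — **a point of `S₀ ×_K Spec C` with countable orbit under the
  twists `𝟙 × Spec τ` is fixed by all of them**: on an affine chart `Spec (C ⊗_K R)` through the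
  point (base change of an affine open of `S₀`, an open immersion) the twists are `Spec (τ ⊗ id)`
  (the chart step of `exists_isClosed_chart_of_stable`).
* The two hypotheses for `K = ℚ̄ →σ ℂ`: `not_countable_compl_range_qbar` (`ℂ ∖ σ(ℚ̄)` is
  uncountable: algebraic numbers are countable, `ℂ` is not) and
  `exists_algEquiv_apply_eq_of_not_mem_range_qbar` (`Aut(ℂ/ℚ̄)` is transitive on transcendentals:
  the embeddings `ℚ̄(X) → ℂ`, `X ↦ c, c'`, extending `σ` are conjugate,
  `FieldTheory.AlgClosed.exists_ringEquiv_apply_eq`).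

## Mathlib / tree search

Mathlib (pin v4.32.0) has no field of definition of an ideal / subspace and no statement about
orbits of subvarieties under field automorphisms (`lean search` for `field of definition`,
`IsGenericPoint.*comap`, `mapRange.*Countable`: nothing); the tree has the STABLE case
(`mem_span_fixedCoord_of_stable`, `ideal_eq_map_comap_includeRight_of_stable`,
`exists_isClosed_preimage_fst_eq_of_stable`) and the automorphism-extension lemmas of
`FieldTheory/AlgClosed/AutomorphismExtension.lean`, both reused here.

## References

* [Lang1958IAG] S. Lang, *Introduction to Algebraic Geometry*, Interscience 1958, Ch. III §2
  Thm. 7 (automorphism-stable ideals and their smallest field of definition), §4–§5 (conjugate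
  varieties, `k`-closed sets).
* [Voisin2007HodgeLoci] C. Voisin, *Hodge loci and absolute Hodge classes*, Compos. Math. 143
  (2007), §1 and Thm. 0.5 (2).
* [CharlesSchnell2014Notes] F. Charles, C. Schnell, *Notes on absolute Hodge classes* (2014), §11.3.
-/

noncomputable section

open CategoryTheory CategoryTheory.Limits AlgebraicGeometry

namespace Literature.AlgebraicGeometry.HodgeTheory

universe u v w

/-! ### Linear algebra: subspaces of `C^{(ι)}` with countable `Aut(C/K)`-orbit are stable -/

section LinearOrbit

variable {K : Type u} {C : Type v} [Field K] [Field C] [Algebra K C] {ι : Type w}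

/-- **Every subspace of `C^{(ι)}` is spanned by its normalised minimal-support vectors**
(induction on the size of the support, as in Lang III §2 Thm. 7). [cite: Lang1958IAG, Ch. III §2, Thm. 7] -/
theorem mem_span_minSupp (V : Submodule C (ι →₀ C)) :
    ∀ v ∈ V, v ∈ Submodule.span C
      {u | (u ∈ V ∧ ∀ w ∈ V, w.support ⊂ u.support → w = 0) ∧ ∃ j, u j = 1} := by
  classical
  suffices h : ∀ n : ℕ, ∀ v ∈ V, v.support.card = n →
      v ∈ Submodule.span C
      {u | (u ∈ V ∧ ∀ w ∈ V, w.support ⊂ u.support → w = 0) ∧ ∃ j, u j = 1} from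
    fun v hv => h _ v hv rfl
  intro n
  induction n using Nat.strong_induction_on with
  | _ n ih =>
  intro v hv hcard
  by_cases hv0 : v = 0
  · subst hv0; exact Submodule.zero_mem _
  -- vectors of `V` with support inside `supp v`, of minimal support size
  have hex : ∃ m : ℕ, ∃ w ∈ V, w ≠ 0 ∧ w.support ⊆ v.support ∧ w.support.card = m :=
    ⟨_, v, hv, hv0, subset_rfl, rfl⟩
  obtain ⟨w, hwV, hw0, hwsupp, hwcard⟩ := Nat.find_spec hex
  have hmin : ∀ w' ∈ V, w' ≠ 0 → w'.support ⊆ v.support → Nat.find hex ≤ w'.support.card :=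
    fun w' h1 h2 h3 => Nat.find_min' hex ⟨w', h1, h2, h3, rfl⟩
  -- normalise `w` at some index `j` of its support
  obtain ⟨j, hj⟩ : w.support.Nonempty := Finsupp.support_nonempty_iff.mpr hw0
  have hwj : w j ≠ 0 := Finsupp.mem_support_iff.mp hj
  set w₁ : ι →₀ C := (w j)⁻¹ • w with hw₁
  have hw₁V : w₁ ∈ V := V.smul_mem _ hwV
  have hw₁j : w₁ j = 1 := by simp [hw₁, hwj]
  have hw₁supp : w₁.support = w.support := by
    rw [hw₁, Finsupp.support_smul_eq (inv_ne_zero hwj)]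
  have hw₁min : w₁ ∈ V ∧ ∀ w' ∈ V, w'.support ⊂ w₁.support → w' = 0 := by
    refine ⟨hw₁V, fun w' hw'V hss => ?_⟩
    by_contra hne
    rw [hw₁supp] at hss
    have hle := hmin w' hw'V hne (hss.subset.trans hwsupp)
    have hlt := Finset.card_lt_card hss
    rw [hwcard] at hlt
    exact absurd hle (not_le.mpr hlt)
  have hw₁span : w₁ ∈ Submodule.span C
      {u | (u ∈ V ∧ ∀ w ∈ V, w.support ⊂ u.support → w = 0) ∧ ∃ j, u j = 1} :=
    Submodule.subset_span ⟨hw₁min, j, hw₁j⟩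
  -- subtract to kill the `j`-th coordinate of `v` and apply induction
  set v' : ι →₀ C := v - v j • w₁ with hv'
  have hv'V : v' ∈ V := V.sub_mem hv (V.smul_mem _ hw₁V)
  have hjv : j ∈ v.support := hwsupp hj
  have hv'supp : v'.support ⊆ v.support.erase j := by
    intro i hi
    rw [Finset.mem_erase]
    rw [Finsupp.mem_support_iff] at hi
    constructor
    · rintro rfl
      apply hi
      simp [hv', hw₁j]
    · rw [Finsupp.mem_support_iff]
      intro h0
      apply hi
      have : w₁ i = 0 := by
        rw [← Finsupp.notMem_support_iff, hw₁supp]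
        intro hi'
        exact (Finsupp.mem_support_iff.mp (hwsupp hi')) h0
      simp [hv', h0, this]
  have hlt : v'.support.card < n := by
    rw [← hcard]
    exact lt_of_le_of_lt (Finset.card_le_card hv'supp) (Finset.card_erase_lt_of_mem hjv)
  have hv'span := ih _ hlt v' hv'V rfl
  have : v = v' + v j • w₁ := by simp [hv']
  rw [this]
  exact Submodule.add_mem _ hv'span (Submodule.smul_mem _ _ hw₁span)

/-- **Uniqueness of the normalised minimal-support vector**: a vector of `V` supported inside the
support of a minimal-support vector `u` and agreeing with `u` at a coordinate where `u = 1`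
equals `u`. [cite: Lang1958IAG, Ch. III §2, Thm. 7] -/
theorem eq_of_minSupp_of_apply_eq_one {V : Submodule C (ι →₀ C)} {u x : ι →₀ C}
    (hu : u ∈ V ∧ ∀ w ∈ V, w.support ⊂ u.support → w = 0) {j : ι} (huj : u j = 1) (hx : x ∈ V)
    (hxsupp : x.support ⊆ u.support) (hxj : x j = 1) : x = u := by
  classical
  have hd : x - u ∈ V := V.sub_mem hx hu.1
  have hdsupp : (x - u).support ⊂ u.support := by
    rw [Finset.ssubset_iff_of_subset]
    · refine ⟨j, Finsupp.mem_support_iff.mpr (by rw [huj]; exact one_ne_zero), ?_⟩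
      rw [Finsupp.mem_support_iff, not_not, Finsupp.sub_apply, hxj, huj, sub_self]
    · intro i hi
      by_contra hiu
      rw [Finsupp.mem_support_iff] at hi
      apply hi
      have hxi : x i = 0 := Finsupp.notMem_support_iff.mp fun h => hiu (hxsupp h)
      have hui : u i = 0 := Finsupp.notMem_support_iff.mp hiu
      rw [Finsupp.sub_apply, hxi, hui, sub_zero]
  exact sub_eq_zero.mp (hu.2 _ hd hdsupp)

/-- **A subspace of `C^{(ι)}` whose `Aut(C/K)`-orbit is countable is `Aut(C/K)`-stable**,
provided `Aut(C/K)` is transitive on the elements of `C` outside `K` and there are uncountably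
many of them (both hold for `ℚ̄ ⊆ ℂ`). Canonical-form argument: `V` is spanned by its normalised
minimal-support vectors (`mem_span_minSupp`), unique given support and normalising index
(`eq_of_minSupp_of_apply_eq_one`); if one of them has a coordinate `c ∉ K`, the conjugates
`τ⁻¹ · V` with `τ c = c'` are pairwise distinct for distinct `c' ∉ K`. This is the mechanism of the
minimal field of definition of a vector subspace / an ideal (Lang III §2 Thm. 7; Weil).
[cite: Lang1958IAG, Ch. III §2, Thm. 7] -/
theorem finsupp_twist_mem_of_countable
    (htrans : ∀ c c' : C, c ∉ Set.range (algebraMap K C) → c' ∉ Set.range (algebraMap K C) →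
      ∃ τ : C ≃ₐ[K] C, τ c = c')
    (hunc : ¬ (Set.range (algebraMap K C))ᶜ.Countable)
    (V : Submodule C (ι →₀ C))
    (hcount : (Set.range fun τ : C ≃ₐ[K] C =>
      {v : ι →₀ C | Finsupp.mapRange τ (map_zero τ) v ∈ V}).Countable) :
    ∀ τ : C ≃ₐ[K] C, ∀ v ∈ V, Finsupp.mapRange τ (map_zero τ) v ∈ V := by
  classical
  by_cases hrat : ∀ u : ι →₀ C, (u ∈ V ∧ ∀ w ∈ V, w.support ⊂ u.support → w = 0) →
      (∃ j, u j = 1) → ∀ i, u i ∈ Set.range (algebraMap K C)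
  · intro τ v hv
    have hv' := mem_span_minSupp V v hv
    refine Submodule.span_induction (p := fun x _ => Finsupp.mapRange τ (map_zero τ) x ∈ V)
      ?_ ?_ ?_ ?_ hv'
    · rintro u ⟨hu, hj⟩
      have : Finsupp.mapRange τ (map_zero τ) u = u := by
        ext i
        obtain ⟨a, ha⟩ := hrat u hu hj i
        rw [Finsupp.mapRange_apply, ← ha, AlgEquiv.commutes]
      rw [this]
      exact hu.1
    · simp
    · intro x y _ _ hx hy
      rw [Finsupp.mapRange_add (map_add τ)]
      exact V.add_mem hx hy
    · intro a x _ hx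
      have : Finsupp.mapRange τ (map_zero τ) (a • x) =
          τ a • Finsupp.mapRange τ (map_zero τ) x := by
        ext i
        simp [map_mul]
      rw [this]
      exact V.smul_mem _ hx
  · exfalso
    push Not at hrat
    obtain ⟨u, hu, ⟨j, hj⟩, i, hi⟩ := hrat
    have hex : ∀ c' : ↥(Set.range (algebraMap K C))ᶜ, ∃ υ : C ≃ₐ[K] C, υ (u i) = c' :=
      fun c' => htrans _ _ hi c'.2
    choose υ hυ using hex
    haveI : Countable ↥(Set.range fun τ : C ≃ₐ[K] C =>
        {v : ι →₀ C | Finsupp.mapRange τ (map_zero τ) v ∈ V}) := hcount.to_subtype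
    let f : ↥(Set.range (algebraMap K C))ᶜ → ↥(Set.range fun τ : C ≃ₐ[K] C =>
        {v : ι →₀ C | Finsupp.mapRange τ (map_zero τ) v ∈ V}) := fun c' =>
      ⟨{v | Finsupp.mapRange ((υ c').symm : C ≃ₐ[K] C) (map_zero _) v ∈ V}, (υ c').symm, rfl⟩
    have hf : Function.Injective f := by
      intro c' c'' h
      have hset : {v : ι →₀ C | Finsupp.mapRange ((υ c').symm : C ≃ₐ[K] C) (map_zero _) v ∈ V} =
          {v | Finsupp.mapRange ((υ c'').symm : C ≃ₐ[K] C) (map_zero _) v ∈ V} :=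
        congrArg Subtype.val h
      set x' : ι →₀ C := Finsupp.mapRange (υ c') (map_zero _) u with hx'
      have hx'mem : x' ∈ {v : ι →₀ C |
          Finsupp.mapRange ((υ c').symm : C ≃ₐ[K] C) (map_zero _) v ∈ V} := by
        show Finsupp.mapRange _ _ x' ∈ V
        have : Finsupp.mapRange ((υ c').symm : C ≃ₐ[K] C) (map_zero _) x' = u := by
          ext k
          simp [hx']
        rw [this]
        exact hu.1
      rw [hset] at hx'mem
      set y : ι →₀ C := Finsupp.mapRange ((υ c'').symm : C ≃ₐ[K] C) (map_zero _) x' with hy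
      have hyV : y ∈ V := hx'mem
      have hysupp : y.support ⊆ u.support :=
        Finsupp.support_mapRange.trans Finsupp.support_mapRange
      have hyj : y j = 1 := by simp [hy, hx', hj]
      have hyu := eq_of_minSupp_of_apply_eq_one hu hj hyV hysupp hyj
      have hyi := DFunLike.congr_fun hyu i
      simp only [hy, hx', Finsupp.mapRange_apply] at hyi
      rw [AlgEquiv.symm_apply_eq] at hyi
      apply Subtype.ext
      rw [← hυ c', ← hυ c'']
      exact hyi
    exact hunc (Set.countable_coe_iff.mp hf.countable)

end LinearOrbit

/-! ### The field-theoretic inputs for `ℚ̄ ⊆ ℂ` -/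

section ComplexField

open Cardinal Polynomial

variable (σ : AlgebraicClosure ℚ →+* ℂ)

/-- **The complement of `σ(ℚ̄) ⊆ ℂ` is uncountable**: `σ(ℚ̄)` consists of algebraic numbers, a
countable set, and `ℂ` is uncountable. [folklore] -/
theorem not_countable_compl_range_qbar :
    letI := σ.toAlgebra
    ¬ (Set.range (algebraMap (AlgebraicClosure ℚ) ℂ))ᶜ.Countable := by
  letI := σ.toAlgebra
  change ¬ (Set.range σ)ᶜ.Countable
  intro hc
  haveI : Algebra.IsAlgebraic ℚ (AlgebraicClosure ℚ) := AlgebraicClosure.isAlgebraic ℚ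
  have halg : Set.range σ ⊆ {y : ℂ | IsAlgebraic ℚ y} := by
    rintro _ ⟨a, rfl⟩
    exact (Algebra.IsAlgebraic.isAlgebraic (R := ℚ) a).algHom σ.toRatAlgHom
  have hcountAlg : {y : ℂ | IsAlgebraic ℚ y}.Countable := by
    haveI : Countable ℚ[X] :=
      Cardinal.mk_le_aleph0_iff.mp (Polynomial.cardinalMk_le_max.trans (by simp))
    have hsub' : {y : ℂ | IsAlgebraic ℚ y} ⊆ ⋃ p : ℚ[X], p.rootSet ℂ := by
      rintro y ⟨p, hp0, hpy⟩
      exact Set.mem_iUnion.2 ⟨p, Polynomial.mem_rootSet.2 ⟨hp0, hpy⟩⟩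
    exact (Set.countable_iUnion fun p => (Polynomial.rootSet_finite p ℂ).countable).mono hsub'
  have huniv : (Set.univ : Set ℂ).Countable := by
    rw [← Set.union_compl_self (Set.range σ)]
    exact (hcountAlg.mono halg).union hc
  exact not_countable_complex huniv

/-- **`Aut(ℂ/ℚ̄)` is transitive on transcendental numbers**: for `c, c' ∉ σ(ℚ̄)` there is a
`ℚ̄`-algebra automorphism `τ` of `ℂ` with `τ c = c'` (the embeddings `ℚ̄(X) → ℂ`, `X ↦ c` and
`X ↦ c'`, both extending `σ`, are conjugate: `FieldTheory.AlgClosed.exists_ringEquiv_apply_eq`).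
[folklore] -/
theorem exists_algEquiv_apply_eq_of_not_mem_range_qbar {c c' : ℂ}
    (hc : c ∉ Set.range σ) (hc' : c' ∉ Set.range σ) :
    letI := σ.toAlgebra
    ∃ τ : ℂ ≃ₐ[AlgebraicClosure ℚ] ℂ, τ c = c' := by
  letI := σ.toAlgebra
  have htc : ∀ d : ℂ, d ∉ Set.range σ → Transcendental (AlgebraicClosure ℚ) d :=
    fun d hd halg => hd (mem_range_algebraMap_of_isIntegral_of_isAlgClosed halg.isIntegral)
  -- the embeddings `ℚ̄(X) → ℂ`, `X ↦ d`, extending `σ`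
  have hemb : ∀ d : ℂ, d ∉ Set.range σ →
      ∃ φ : RatFunc (AlgebraicClosure ℚ) →+* ℂ, φ RatFunc.X = d ∧
        ∀ a : AlgebraicClosure ℚ,
          φ (algebraMap (AlgebraicClosure ℚ)[X] (RatFunc (AlgebraicClosure ℚ)) (Polynomial.C a)) =
            σ a := by
    intro d hd
    have hinj : Function.Injective (Polynomial.aeval (R := AlgebraicClosure ℚ) d) :=
      transcendental_iff_injective.mp (htc d hd)
    have hφ : nonZeroDivisors (AlgebraicClosure ℚ)[X] ≤
        (nonZeroDivisors ℂ).comap (Polynomial.aeval (R := AlgebraicClosure ℚ) d).toRingHom := by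
      intro p hp
      simp only [Submonoid.mem_comap]
      refine mem_nonZeroDivisors_of_ne_zero ?_
      intro h0
      have : p = 0 := hinj (by simpa using h0)
      exact nonZeroDivisors.ne_zero hp this
    refine ⟨RatFunc.liftRingHom (Polynomial.aeval (R := AlgebraicClosure ℚ) d).toRingHom hφ,
      ?_, ?_⟩
    · rw [← RatFunc.algebraMap_X, show (algebraMap (AlgebraicClosure ℚ)[X]
          (RatFunc (AlgebraicClosure ℚ))) Polynomial.X =
        algebraMap (AlgebraicClosure ℚ)[X] (RatFunc (AlgebraicClosure ℚ)) Polynomial.X /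
          algebraMap (AlgebraicClosure ℚ)[X] (RatFunc (AlgebraicClosure ℚ)) 1 by simp,
        RatFunc.liftRingHom_apply_div]
      simp
    · intro a
      rw [show (algebraMap (AlgebraicClosure ℚ)[X] (RatFunc (AlgebraicClosure ℚ))) (Polynomial.C a) =
        algebraMap (AlgebraicClosure ℚ)[X] (RatFunc (AlgebraicClosure ℚ)) (Polynomial.C a) /
          algebraMap (AlgebraicClosure ℚ)[X] (RatFunc (AlgebraicClosure ℚ)) 1 by simp,
        RatFunc.liftRingHom_apply_div]
      simp
      rfl
  obtain ⟨φ, hφX, hφC⟩ := hemb c hc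
  obtain ⟨φ', hφ'X, hφ'C⟩ := hemb c' hc'
  have hΩ : ℵ₀ < #ℂ := by rw [Cardinal.mk_complex]; exact Cardinal.aleph0_lt_continuum
  haveI : Algebra.IsAlgebraic ℚ (AlgebraicClosure ℚ) := AlgebraicClosure.isAlgebraic ℚ
  have hK : #(AlgebraicClosure ℚ) ≤ ℵ₀ := by
    refine (Algebra.IsAlgebraic.cardinalMk_le_max ℚ (AlgebraicClosure ℚ)).trans ?_
    simp
  have hF : #(RatFunc (AlgebraicClosure ℚ)) ≤ ℵ₀ :=
    calc #(RatFunc (AlgebraicClosure ℚ)) ≤ #((AlgebraicClosure ℚ)[X]) :=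
          IsLocalization.cardinalMk_le (nonZeroDivisors (AlgebraicClosure ℚ)[X])
      _ ≤ max #(AlgebraicClosure ℚ) ℵ₀ := Polynomial.cardinalMk_le_max
      _ ≤ ℵ₀ := max_le hK le_rfl
  obtain ⟨ρ, hρ⟩ := Literature.FieldTheory.AlgClosed.exists_ringEquiv_apply_eq hΩ hF φ φ'
  have hcomm : ∀ a : AlgebraicClosure ℚ,
      ρ (algebraMap (AlgebraicClosure ℚ) ℂ a) = algebraMap (AlgebraicClosure ℚ) ℂ a := by
    intro a
    change ρ (σ a) = σ a
    have h := hρ (algebraMap (AlgebraicClosure ℚ)[X] (RatFunc (AlgebraicClosure ℚ)) (Polynomial.C a))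
    rwa [hφC, hφ'C] at h
  refine ⟨AlgEquiv.ofRingEquiv (f := ρ) hcomm, ?_⟩
  change ρ c = c'
  rw [← hφX, hρ, hφ'X]

end ComplexField

/-! ### Ideals of `C ⊗_K R` with countable `Aut(C/K)`-orbit are stable -/

section TensorOrbit

open scoped TensorProduct

variable {K : Type u} {C : Type u} [Field K] [Field C] [Algebra K C]
  {R : Type u} [CommRing R] [Algebra K R]

/-- **An ideal of `C ⊗_K R` whose orbit under the twists `τ ⊗ id`, `τ ∈ Aut(C/K)`, is countable
is stable under all of them** (under the two hypotheses on `K ⊆ C` of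
`finsupp_twist_mem_of_countable`): in coordinates with respect to the `C`-basis `1 ⊗ bᵢ` coming
from a `K`-basis of `R`, the twist acts coordinatewise (`HodgeTheory.basis_repr_map_algEquiv`) and
the ideal becomes a subspace of `C^{(ι)}` with countable orbit. This is the minimal field of
definition of an ideal (Lang III §2 Thm. 7; Weil) run for countable orbits.
[cite: Lang1958IAG, Ch. III §2, Thm. 7] -/
theorem tensor_twist_mem_of_countable
    (htrans : ∀ c c' : C, c ∉ Set.range (algebraMap K C) → c' ∉ Set.range (algebraMap K C) →
      ∃ τ : C ≃ₐ[K] C, τ c = c')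
    (hunc : ¬ (Set.range (algebraMap K C))ᶜ.Countable)
    (P : Ideal (C ⊗[K] R))
    (hcount : (Set.range fun τ : C ≃ₐ[K] C =>
      P.comap (Algebra.TensorProduct.map (τ : C →ₐ[K] C) (AlgHom.id K R)).toRingHom).Countable) :
    ∀ τ : C ≃ₐ[K] C, ∀ x ∈ P,
      Algebra.TensorProduct.map (τ : C →ₐ[K] C) (AlgHom.id K R) x ∈ P := by
  classical
  obtain ⟨ι, b⟩ := Module.Free.exists_basis (R := K) (M := R)
  set B := Algebra.TensorProduct.basis C b with hB
  -- the coordinate subspace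
  let V : Submodule C (ι →₀ C) :=
    (P.restrictScalars C).comap (B.repr.symm : (ι →₀ C) →ₗ[C] C ⊗[K] R)
  have hVmem : ∀ v, v ∈ V ↔ B.repr.symm v ∈ P := fun v => Iff.rfl
  have hkey : ∀ (τ : C ≃ₐ[K] C) (v : ι →₀ C),
      B.repr.symm (Finsupp.mapRange τ (map_zero τ) v) =
        Algebra.TensorProduct.map (τ : C →ₐ[K] C) (AlgHom.id K R) (B.repr.symm v) := by
    intro τ v
    have h := basis_repr_map_algEquiv b τ (B.repr.symm v)
    rw [LinearEquiv.apply_symm_apply] at h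
    rw [← h, LinearEquiv.symm_apply_apply]
  have hVτ : ∀ τ : C ≃ₐ[K] C, {v : ι →₀ C | Finsupp.mapRange τ (map_zero τ) v ∈ V} =
      (fun v : ι →₀ C => B.repr.symm v) ⁻¹'
        (P.comap (Algebra.TensorProduct.map (τ : C →ₐ[K] C) (AlgHom.id K R)).toRingHom :
          Set (C ⊗[K] R)) := by
    intro τ
    ext v
    simp only [Set.mem_setOf_eq, Set.mem_preimage, SetLike.mem_coe, Ideal.mem_comap]
    rw [hVmem, hkey]
    rfl
  have hcountV : (Set.range fun τ : C ≃ₐ[K] C =>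
      {v : ι →₀ C | Finsupp.mapRange τ (map_zero τ) v ∈ V}).Countable := by
    have hrange : (Set.range fun τ : C ≃ₐ[K] C =>
        {v : ι →₀ C | Finsupp.mapRange τ (map_zero τ) v ∈ V}) =
        (fun I : Ideal (C ⊗[K] R) => (fun v : ι →₀ C => B.repr.symm v) ⁻¹' (I : Set (C ⊗[K] R))) ''
          Set.range (fun τ : C ≃ₐ[K] C =>
            P.comap (Algebra.TensorProduct.map (τ : C →ₐ[K] C) (AlgHom.id K R)).toRingHom) := by
      rw [← Set.range_comp]
      congr 1
      funext τ
      exact hVτ τ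
    rw [hrange]
    exact hcount.image _
  have hstab := finsupp_twist_mem_of_countable htrans hunc V hcountV
  intro τ x hx
  have hxV : B.repr x ∈ V := by
    rw [hVmem, LinearEquiv.symm_apply_apply]
    exact hx
  have h := hstab τ _ hxV
  rw [hVmem, hkey, LinearEquiv.symm_apply_apply] at h
  exact h

/-- The twists `τ⁻¹ ⊗ id` and `τ ⊗ id` of `C ⊗_K R` are mutually inverse. [folklore] -/
theorem tensor_twist_symm_apply (τ : C ≃ₐ[K] C) (x : C ⊗[K] R) :
    Algebra.TensorProduct.map ((τ.symm : C ≃ₐ[K] C) : C →ₐ[K] C) (AlgHom.id K R)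
      (Algebra.TensorProduct.map (τ : C →ₐ[K] C) (AlgHom.id K R) x) = x := by
  induction x using TensorProduct.induction_on with
  | zero => simp
  | tmul c r => simp [Algebra.TensorProduct.map_tmul]
  | add x y hx hy => rw [map_add, map_add, hx, hy]

/-- **Countable orbit ⟹ fixed, for ideals of `C ⊗_K R`**: if the orbit of an ideal `P` under the
twists `τ ⊗ id` is countable then every twist fixes `P` (as `comap`). [cite: Lang1958IAG, Ch. III §2, Thm. 7] -/
theorem ideal_comap_tensor_twist_eq_of_countable
    (htrans : ∀ c c' : C, c ∉ Set.range (algebraMap K C) → c' ∉ Set.range (algebraMap K C) →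
      ∃ τ : C ≃ₐ[K] C, τ c = c')
    (hunc : ¬ (Set.range (algebraMap K C))ᶜ.Countable)
    (P : Ideal (C ⊗[K] R))
    (hcount : (Set.range fun τ : C ≃ₐ[K] C =>
      P.comap (Algebra.TensorProduct.map (τ : C →ₐ[K] C) (AlgHom.id K R)).toRingHom).Countable)
    (τ : C ≃ₐ[K] C) :
    P.comap (Algebra.TensorProduct.map (τ : C →ₐ[K] C) (AlgHom.id K R)).toRingHom = P := by
  have hstab := tensor_twist_mem_of_countable htrans hunc P hcount
  apply le_antisymm
  · intro x hx
    rw [Ideal.mem_comap] at hx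
    have h := hstab τ.symm _ hx
    change Algebra.TensorProduct.map ((τ.symm : C ≃ₐ[K] C) : C →ₐ[K] C) (AlgHom.id K R)
      (Algebra.TensorProduct.map (τ : C →ₐ[K] C) (AlgHom.id K R) x) ∈ P at h
    rwa [tensor_twist_symm_apply] at h
  · intro x hx
    rw [Ideal.mem_comap]
    exact hstab τ x hx

end TensorOrbit

/-! ### Points of `S₀ ×_K Spec C` with countable orbit under the Galois twists are fixed -/

section SchemeOrbit

open scoped TensorProduct

variable {K : Type u} {C : Type u} [Field K] [Field C] [Algebra K C]

/-- **A point of `S₀ ×_K Spec C` whose orbit under the Galois twists `𝟙 × Spec τ`,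
`τ ∈ Aut(C/K)`, is countable is fixed by all of them** (under the two hypotheses on `K ⊆ C` of
`finsupp_twist_mem_of_countable`). On an affine chart `Spec (C ⊗_K R) ⟶ S₀ ×_K Spec C` through
the point (the base change of an affine open `Spec R ⟶ S₀`, an open immersion) the twists are
`Spec (τ ⊗ id)` and the point is a prime ideal of `C ⊗_K R` with countable orbit
(`ideal_comap_tensor_twist_eq_of_countable`). This is the statement "a closed irreducible subset
with countably many Galois conjugates is defined over `K`" at the generic point (Weil; Lang III
§2 Thm. 7 and §4–§5; Voisin 2007, §1). [cite: Lang1958IAG, Ch. III §2, Thm. 7] -/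
theorem twist_apply_eq_self_of_countable
    (htrans : ∀ c c' : C, c ∉ Set.range (algebraMap K C) → c' ∉ Set.range (algebraMap K C) →
      ∃ τ : C ≃ₐ[K] C, τ c = c')
    (hunc : ¬ (Set.range (algebraMap K C))ᶜ.Countable)
    (S₀ : Over (Spec (CommRingCat.of K)))
    (ψ : (C ≃ₐ[K] C) → (pullback S₀.hom (Spec.map (CommRingCat.ofHom (algebraMap K C))) ⟶
        pullback S₀.hom (Spec.map (CommRingCat.ofHom (algebraMap K C)))))
    (hψ1 : ∀ τ, ψ τ ≫ pullback.fst _ _ = pullback.fst _ _)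
    (hψ2 : ∀ τ, ψ τ ≫ pullback.snd _ _ =
      pullback.snd _ _ ≫ Spec.map (CommRingCat.ofHom (τ : C →+* C)))
    (η : ↥(pullback S₀.hom (Spec.map (CommRingCat.ofHom (algebraMap K C)))))
    (hcount : (Set.range fun τ => ψ τ η).Countable) :
    ∀ τ, ψ τ η = η := by
  classical
  set x₀ := pullback.fst S₀.hom (Spec.map (CommRingCat.ofHom (algebraMap K C))) η with hx₀
  let 𝒰 := S₀.left.affineOpenCover
  obtain ⟨y, hy⟩ := 𝒰.covers x₀
  haveI : IsOpenImmersion (𝒰.f (𝒰.idx x₀)) := 𝒰.map_prop _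
  -- `R` is a `K`-algebra through `Spec R ⟶ S₀ ⟶ Spec K`
  letI : Algebra K (𝒰.X (𝒰.idx x₀)) := (Spec.preimage (𝒰.f (𝒰.idx x₀) ≫ S₀.hom)).hom.toAlgebra
  have halg : Spec.map (CommRingCat.ofHom (algebraMap K (𝒰.X (𝒰.idx x₀)))) =
      𝒰.f (𝒰.idx x₀) ≫ S₀.hom := by
    rw [RingHom.algebraMap_toAlgebra, CommRingCat.ofHom_hom, Spec.map_preimage]
  set incL := Algebra.TensorProduct.includeLeftRingHom (R := K) (A := C) (B := 𝒰.X (𝒰.idx x₀))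
    with hincL
  set incR := (Algebra.TensorProduct.includeRight (R := K) (A := C) (B := 𝒰.X (𝒰.idx x₀))).toRingHom
    with hincR
  -- the square `Spec (C ⊗ R) → Spec C`, `Spec R → Spec K` is cartesian
  have s : IsPullback (Spec.map (CommRingCat.ofHom incL)) (Spec.map (CommRingCat.ofHom incR))
      (Spec.map (CommRingCat.ofHom (algebraMap K C))) (𝒰.f (𝒰.idx x₀) ≫ S₀.hom) := by
    rw [← halg]
    exact isPullback_SpecMap_of_isPushout _ _ _ _
      (CommRingCat.isPushout_tensorProduct K C (𝒰.X (𝒰.idx x₀)))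
  have t : IsPullback (pullback.snd S₀.hom (Spec.map (CommRingCat.ofHom (algebraMap K C))))
      (pullback.fst _ _) (Spec.map (CommRingCat.ofHom (algebraMap K C))) S₀.hom :=
    (IsPullback.of_hasPullback _ _).flip
  have sq := IsPullback.of_right' s t
  set m := t.lift (Spec.map (CommRingCat.ofHom incL))
    (Spec.map (CommRingCat.ofHom incR) ≫ 𝒰.f (𝒰.idx x₀)) (by rw [s.w, Category.assoc]) with hm
  have hmsnd : m ≫ pullback.snd _ _ = Spec.map (CommRingCat.ofHom incL) := t.lift_fst _ _ _
  have hmfst : m ≫ pullback.fst _ _ = Spec.map (CommRingCat.ofHom incR) ≫ 𝒰.f (𝒰.idx x₀) :=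
    t.lift_snd _ _ _
  -- the chart is an open immersion (base change of one), hence injective
  haveI : IsOpenImmersion m := MorphismProperty.of_isPullback sq.flip inferInstance
  have hinj : Function.Injective m := m.isOpenEmbedding.injective
  -- `η` lies in the chart
  obtain ⟨p, hpη, hpy⟩ := Scheme.exists_preimage_of_isPullback sq η y hy.symm
  -- the twists restrict to `Spec (τ ⊗ id)` on the chart
  have hcomm : ∀ τ : C ≃ₐ[K] C,
      Spec.map (CommRingCat.ofHom
        (Algebra.TensorProduct.map (τ : C →ₐ[K] C) (AlgHom.id K (𝒰.X (𝒰.idx x₀)))).toRingHom) ≫ m =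
        m ≫ ψ τ := by
    intro τ
    set θ := (Algebra.TensorProduct.map (τ : C →ₐ[K] C) (AlgHom.id K (𝒰.X (𝒰.idx x₀)))).toRingHom
      with hθ
    have hθR : θ.comp incR = incR := by
      ext r
      simp [hθ, hincR]
    have hθL : θ.comp incL = incL.comp (τ : C →+* C) := by
      ext c
      simp [hθ, hincL]
    apply pullback.hom_ext
    · simp only [Category.assoc, hψ1]
      rw [hmfst, ← Spec.map_comp_assoc, ← CommRingCat.ofHom_comp, hθR]
    · simp only [Category.assoc, hψ2]
      rw [reassoc_of% hmsnd, hmsnd, ← Spec.map_comp, ← Spec.map_comp, ← CommRingCat.ofHom_comp,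
        ← CommRingCat.ofHom_comp, hθL]
  have hψp : ∀ τ : C ≃ₐ[K] C, ψ τ η = m (PrimeSpectrum.comap
      (Algebra.TensorProduct.map (τ : C →ₐ[K] C) (AlgHom.id K (𝒰.X (𝒰.idx x₀)))).toRingHom p) := by
    intro τ
    rw [← hpη, ← Scheme.Hom.comp_apply, ← hcomm, Scheme.Hom.comp_apply]
    rfl
  -- the orbit of the prime `p` is countable
  have hcountp : (Set.range fun τ : C ≃ₐ[K] C => PrimeSpectrum.comap
      (Algebra.TensorProduct.map (τ : C →ₐ[K] C) (AlgHom.id K (𝒰.X (𝒰.idx x₀)))).toRingHom p).Countable := by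
    refine (hcount.preimage hinj).mono ?_
    rintro _ ⟨τ, rfl⟩
    exact ⟨τ, hψp τ ▸ rfl⟩
  have hcountI : (Set.range fun τ : C ≃ₐ[K] C => p.asIdeal.comap
      (Algebra.TensorProduct.map (τ : C →ₐ[K] C) (AlgHom.id K (𝒰.X (𝒰.idx x₀)))).toRingHom).Countable := by
    have hrange : (Set.range fun τ : C ≃ₐ[K] C => p.asIdeal.comap
        (Algebra.TensorProduct.map (τ : C →ₐ[K] C) (AlgHom.id K (𝒰.X (𝒰.idx x₀)))).toRingHom) =
        PrimeSpectrum.asIdeal '' Set.range (fun τ : C ≃ₐ[K] C => PrimeSpectrum.comap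
          (Algebra.TensorProduct.map (τ : C →ₐ[K] C) (AlgHom.id K (𝒰.X (𝒰.idx x₀)))).toRingHom p) := by
      rw [← Set.range_comp]
      rfl
    rw [hrange]
    exact hcountp.image _
  intro τ
  rw [hψp τ, ← hpη]
  congr 1
  apply PrimeSpectrum.ext
  rw [PrimeSpectrum.comap_asIdeal]
  exact ideal_comap_tensor_twist_eq_of_countable htrans hunc p.asIdeal hcountI τ

end SchemeOrbit

end Literature.AlgebraicGeometry.HodgeTheory

end
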